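import Literature.Probability.Percolation.PositiveAssociationIntegral
import Mathlib.MeasureTheory.Measure.RegularityCompacts
import Mathlib.MeasureTheory.Measure.Portmanteau
import Mathlib.Topology.Maps.Proper.Basic
import Mathlib.Topology.Metrizable.CompletelyMetrizable
import HarnessLib

/-!
# Positive association: compact-generated up-sets suffice, countable products, weak limits
(Lindqvist 1988; Last–Szekli–Yogeshwaran 2020; Grimmett 2006 Prop. 4.10)

Literature formalisation (topic `Literature/Probability/Percolation`, next to
`PositiveAssociation.lean` whose predicate `IsPositivelyAssociated μ` — "`μ A * μ B ≤ μ (A ∩ B)` for all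
measurable upper sets `A, B`" — is exactly Lindqvist's definition (3.1) of an *associated* probability
measure on a partially ordered Polish space).  The tree had the closure of positive association under
monotone images and products (Lindqvist's Thms 3.2, 3.3: `IsPositivelyAssociated.map`, `.prod`) and the
covariance form for bounded measurable monotone functions
(`IsPositivelyAssociated.integral_mul_integral_le_integral_mul`), but none of the *limit* theorems of the
theory.  This file proves them, following the printed proofs:

* `isClosed_upperClosure_of_isCompact` — on a space with closed order, the up-set `↑K = {y | ∃ x ∈ K, x ≤ y}`
  generated by a compact set is closed [Lindqvist1988, §2, citing Nachbin, Prop. 4 p. 44].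
* `IsPositivelyAssociated.of_isCompact`, `.of_isClosed`, `isPositivelyAssociated_iff_isClosed` —
  **Lindqvist's Theorem 3.1, (iv) ⇒ (i)**: for a finite Borel measure that is inner regular by compact sets
  (automatic on Polish spaces), the defining inequality for the *compact-generated* (a fortiori: closed) upper
  sets already gives it for all measurable upper sets [Lindqvist1988, Thm. 3.1: "(iv) ⇒ (i) … Since E is
  Polish there exist compact sets Kᵢ ⊂ Cᵢ with P(Cᵢ) − P(Kᵢ) < ε. Let Hᵢ = Inc(Kᵢ)"].
* `isPositivelyAssociated_pi_of_forall_finset`, `isPositivelyAssociated_pi_iff_forall_finset`,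
  `isPositivelyAssociated_pi_of_cylinders` — **Lindqvist's Theorem 5.1 / Last–Szekli–Yogeshwaran's
  Theorem 3.5**: a finite measure on a countable product `Π i, E i` of ordered spaces with closed orders is
  positively associated iff all its finite-dimensional marginals are [Lindqvist1988, Thm. 5.1;
  LastSzekliYogeshwaran2020, Thm. 3.5: "Assume that for each finite J ⊂ I the finite subfamily X_J is
  (PA). Then the family X is (PA)"].  Proof as in [GrimmettRandomCluster2006, (4.4)–(4.5)]: a compact-generated up-set
  `↑K` is the decreasing limit of its cylinders `{x | ∃ k ∈ K, k ≤ x on J_n}` along an exhaustion `J_n ↑ ι`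
  (a cluster-point argument on the compact `K`), and measures pass to decreasing limits.
* `isPositivelyAssociated_pi_of_tendsto` — **limits**: if `μs k → μ` on every local (cylinder) event and
  every `μs k` is positively associated then so is `μ`; and the genuinely weak-convergence form
  `isPositivelyAssociated_pi_of_tendsto_probabilityMeasure` for countable products of *discrete* ordered
  spaces (configurations `ι → Bool`, `ι → Fin q`, …), where cylinder events are clopen and the portmanteau
  theorem applies [GrimmettRandomCluster2006, Prop. 4.10(b): "Let (μₙ) be a sequence of probability measures on
  (Ω, ℱ), Ω = {0,1}^E … satisfying μₙ ⇒ μ. If each μₙ is positively associated, then so is μ";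
  Lindqvist1988, Thm. 3.5 (normally ordered spaces); LastSzekliYogeshwaran2020, Thm. 3.7].
* `IsPositivelyAssociated.of_continuous_pi` — **continuous monotone functions suffice** on countable
  products of discrete ordered spaces: if `∫ f g dμ ≥ ∫ f dμ ∫ g dμ` for all *continuous* monotone
  `f, g : (Π i, E i) → [0,1]` then `μ` is positively associated (hence, by the tree's
  `integral_mul_integral_le_integral_mul`, the inequality holds for all bounded *measurable* monotone
  `f, g`) [LastSzekliYogeshwaran2020, Lemma 3.6; Lindqvist1988, Thm. 3.1 (v) ⇒ (i); GrimmettRandomCluster2006,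
  (4.8)–(4.9); for `E = ℝ` Esary–Proschan–Walkup 1967].
* Two-valued spins `ι → Bool`: `isPositivelyAssociated_spins_iff_forall_finset`,
  `isPositivelyAssociated_spins_of_tendsto` (the form used for infinite-volume limits of finite-volume
  FKG measures, e.g. Ising/random-cluster states [GrimmettRandomCluster2006, Thm. 4.17(b) via Prop. 4.10(b)]).

## Not here

Lindqvist's (v) ⇒ (i) on a general *normally ordered* Polish space (it needs Nachbin's order-Urysohn
functions) and Last–Szekli–Yogeshwaran's Strassen-coupling proof of Lemma 3.6 for general POP spaces; the
continuous-function criterion is proved here for countable products of discrete ordered spaces (clopen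
cylinders) and of metric chains satisfying Rüschendorf's condition (R1) (`ℝ`, `[0,1]`, subsets of `ℝ`).
Negative association analogues (LSY20 treat PA and NA in parallel) are not vendored.

## References

* [Lindqvist1988] B. H. Lindqvist, Association of probability measures on partially ordered spaces,
  J. Multivariate Anal. 26 (1988) 111–132, doi:10.1016/0047-259X(88)90076-0 — §2 (POP spaces,
  compact generated sets, normal ordering), Thm. 3.1, Thm. 3.5, Thm. 5.1, Thm. 5.2.
* [LastSzekliYogeshwaran2020] G. Last, R. Szekli, D. Yogeshwaran, Some remarks on associated random
  fields, random measures and point processes, ALEA 17 (2020) 355–374, arXiv:1903.06004 — Def. 3.1,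
  Thm. 3.5, Lemma 3.6, Thm. 3.7.
* [GrimmettRandomCluster2006] G. Grimmett, The Random-Cluster Model, Springer 2006 — §4.1, (4.1)–(4.9), Prop. 4.10.
-/

noncomputable section

open MeasureTheory Measure Set Filter Topology
open scoped ENNReal NNReal

namespace Literature.Probability.Percolation

/-! ### Compact-generated upper sets are closed -/

section UpperClosure

variable {Ω : Type*} [TopologicalSpace Ω] [Preorder Ω] [OrderClosedTopology Ω]

/-- On a topological space with closed order relation, the upper set `{y | ∃ x ∈ K, x ≤ y}` generated by a
compact set `K` is closed ("compact generated" increasing sets, `Inc(K)`).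
[cite: Lindqvist1988, §2 ("Then C and D are closed sets by Proposition 4 [24, p. 44]")] -/
theorem isClosed_upperClosure_of_isCompact {K : Set Ω} (hK : IsCompact K) :
    IsClosed (upperClosure K : Set Ω) := by
  haveI : CompactSpace K := isCompact_iff_compactSpace.mp hK
  have hcl : IsClosed {p : K × Ω | (p.1 : Ω) ≤ p.2} :=
    isClosed_le (continuous_subtype_val.comp continuous_fst) continuous_snd
  have himg : (upperClosure K : Set Ω) = Prod.snd '' {p : K × Ω | (p.1 : Ω) ≤ p.2} := by
    ext y
    constructor
    · intro hy
      obtain ⟨a, haK, hay⟩ := mem_upperClosure.mp hy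
      exact ⟨(⟨a, haK⟩, y), hay, rfl⟩
    · rintro ⟨⟨⟨a, haK⟩, y'⟩, hle, rfl⟩
      exact mem_upperClosure.mpr ⟨a, haK, hle⟩
  rw [himg]
  exact isClosedMap_snd_of_compactSpace _ hcl

/-- Dually, the lower set generated by a compact set is closed (`Dec(K)`).
[cite: Lindqvist1988, §2 ("Then C and D are closed sets by Proposition 4 [24, p. 44]")] -/
theorem isClosed_lowerClosure_of_isCompact {K : Set Ω} (hK : IsCompact K) :
    IsClosed (lowerClosure K : Set Ω) := by
  haveI : CompactSpace K := isCompact_iff_compactSpace.mp hK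
  have hcl : IsClosed {p : K × Ω | p.2 ≤ (p.1 : Ω)} :=
    isClosed_le continuous_snd (continuous_subtype_val.comp continuous_fst)
  have himg : (lowerClosure K : Set Ω) = Prod.snd '' {p : K × Ω | p.2 ≤ (p.1 : Ω)} := by
    ext y
    constructor
    · intro hy
      obtain ⟨a, haK, hya⟩ := mem_lowerClosure.mp hy
      exact ⟨(⟨a, haK⟩, y), hya, rfl⟩
    · rintro ⟨⟨⟨a, haK⟩, y'⟩, hle, rfl⟩
      exact mem_lowerClosure.mpr ⟨a, haK, hle⟩
  rw [himg]
  exact isClosedMap_snd_of_compactSpace _ hcl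

/-- A discrete ordered space has closed order (every set is closed); a low-priority instance so that
configuration spaces `ι → Bool`, `ι → Fin q`, … fall under the theorems below (instance plumbing, no
mathematical content). [folklore] -/
instance (priority := 100) orderClosedTopology_of_discreteTopology (α : Type*) [TopologicalSpace α]
    [DiscreteTopology α] [Preorder α] : OrderClosedTopology α :=
  ⟨isClosed_discrete _⟩

end UpperClosure

/-! ### Lindqvist's Theorem 3.1: compact-generated (or closed) upper sets suffice -/

section Lindqvist31

variable {Ω : Type*} [TopologicalSpace Ω] [Preorder Ω] [OrderClosedTopology Ω] [MeasurableSpace Ω]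
  [OpensMeasurableSpace Ω]

omit [OrderClosedTopology Ω] [OpensMeasurableSpace Ω] in
/-- **Lindqvist's Theorem 3.1, (iv) ⇒ (i).**  Let `μ` be a finite Borel measure on an ordered topological
space with closed order, inner regular with respect to compact sets (e.g. any finite measure on a Polish
space).  If `μ(↑K₁) μ(↑K₂) ≤ μ(↑K₁ ∩ ↑K₂)` for all *compact-generated* upper sets `↑Kᵢ = {y | ∃ x ∈ Kᵢ, x ≤ y}`,
`Kᵢ` compact, then `μ` is positively associated: the inequality holds for all measurable upper sets.
Proof as printed: approximate a measurable upper set from inside by a compact `K`, and `K ⊆ ↑K ⊆ A`.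
[cite: Lindqvist1988, Thm. 3.1 ((iv) ⇒ (i))] -/
theorem IsPositivelyAssociated.of_isCompact (μ : Measure Ω) [IsFiniteMeasure μ]
    [μ.InnerRegularCompactLTTop]
    (h : ∀ K₁ K₂ : Set Ω, IsCompact K₁ → IsCompact K₂ →
      μ (upperClosure K₁ : Set Ω) * μ (upperClosure K₂ : Set Ω) ≤
        μ ((upperClosure K₁ : Set Ω) ∩ (upperClosure K₂ : Set Ω))) :
    IsPositivelyAssociated μ := by
  intro A B hA hB hAm hBm
  have hA' := hAm.measure_eq_iSup_isCompact_of_ne_top (measure_ne_top μ A)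
  have hB' := hBm.measure_eq_iSup_isCompact_of_ne_top (measure_ne_top μ B)
  have hKK : ∀ K₁, K₁ ⊆ A → IsCompact K₁ → ∀ K₂, K₂ ⊆ B → IsCompact K₂ →
      μ K₁ * μ K₂ ≤ μ (A ∩ B) := by
    intro K₁ hK₁A hK₁ K₂ hK₂B hK₂
    calc μ K₁ * μ K₂
        ≤ μ (upperClosure K₁ : Set Ω) * μ (upperClosure K₂ : Set Ω) :=
          mul_le_mul' (measure_mono subset_upperClosure) (measure_mono subset_upperClosure)
      _ ≤ μ ((upperClosure K₁ : Set Ω) ∩ (upperClosure K₂ : Set Ω)) := h K₁ K₂ hK₁ hK₂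
      _ ≤ μ (A ∩ B) :=
          measure_mono (inter_subset_inter (upperClosure_min hK₁A hA) (upperClosure_min hK₂B hB))
  calc μ A * μ B = (⨆ (K) (_ : K ⊆ A) (_ : IsCompact K), μ K) * μ B := by rw [← hA']
    _ = ⨆ (K) (_ : K ⊆ A) (_ : IsCompact K), μ K * μ B := by simp only [ENNReal.iSup_mul]
    _ ≤ μ (A ∩ B) := by
        refine iSup_le fun K₁ => iSup_le fun hK₁A => iSup_le fun hK₁ => ?_
        calc μ K₁ * μ B = μ K₁ * ⨆ (K) (_ : K ⊆ B) (_ : IsCompact K), μ K := by rw [← hB']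
          _ = ⨆ (K) (_ : K ⊆ B) (_ : IsCompact K), μ K₁ * μ K := by simp only [ENNReal.mul_iSup]
          _ ≤ μ (A ∩ B) :=
              iSup_le fun K₂ => iSup_le fun hK₂B => iSup_le fun hK₂ => hKK K₁ hK₁A hK₁ K₂ hK₂B hK₂

omit [OpensMeasurableSpace Ω] in
/-- **Lindqvist's Theorem 3.1 with closed upper sets.**  For a finite, compact-inner-regular Borel
measure on an ordered space with closed order, the positive-association inequality for *closed* upper
sets implies it for all measurable upper sets (compact-generated upper sets are closed,
`isClosed_upperClosure_of_isCompact`). [cite: Lindqvist1988, Thm. 3.1 ((iv) ⇒ (i))] -/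
theorem IsPositivelyAssociated.of_isClosed (μ : Measure Ω) [IsFiniteMeasure μ]
    [μ.InnerRegularCompactLTTop]
    (h : ∀ C₁ C₂ : Set Ω, IsClosed C₁ → IsClosed C₂ → IsUpperSet C₁ → IsUpperSet C₂ →
      μ C₁ * μ C₂ ≤ μ (C₁ ∩ C₂)) :
    IsPositivelyAssociated μ :=
  .of_isCompact μ fun K₁ K₂ hK₁ hK₂ =>
    h _ _ (isClosed_upperClosure_of_isCompact hK₁) (isClosed_upperClosure_of_isCompact hK₂)
      (upperClosure K₁).upper (upperClosure K₂).upper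

/-- Positive association ⟺ the inequality for closed upper sets (finite compact-inner-regular Borel
measures, closed order). [cite: Lindqvist1988, Thm. 3.1 ((i) ⟺ (iv))] -/
theorem isPositivelyAssociated_iff_isClosed (μ : Measure Ω) [IsFiniteMeasure μ]
    [μ.InnerRegularCompactLTTop] :
    IsPositivelyAssociated μ ↔ ∀ C₁ C₂ : Set Ω, IsClosed C₁ → IsClosed C₂ → IsUpperSet C₁ →
      IsUpperSet C₂ → μ C₁ * μ C₂ ≤ μ (C₁ ∩ C₂) :=
  ⟨fun hμ C₁ C₂ h₁ h₂ hu₁ hu₂ => hμ C₁ C₂ hu₁ hu₂ h₁.measurableSet h₂.measurableSet,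
    IsPositivelyAssociated.of_isClosed μ⟩

end Lindqvist31

/-! ### Countable products: finite-dimensional marginals suffice (Lindqvist Thm 5.1 / LSY Thm 3.5) -/

section Product

variable {ι : Type*} {E : ι → Type*} [∀ i, TopologicalSpace (E i)] [∀ i, Preorder (E i)]

/-- An exhaustion of a countable index type by an increasing sequence of finite sets. [folklore] -/
private theorem exists_finset_exhaustion (ι : Type*) [Countable ι] :
    ∃ J : ℕ → Finset ι, Monotone J ∧ ∀ i, ∃ n, i ∈ J n := by
  classical
  obtain ⟨g, hg⟩ := exists_surjective_nat (Option ι)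
  refine ⟨fun n => Finset.eraseNone ((Finset.range (n + 1)).image g), fun m n hmn => ?_, fun i => ?_⟩
  · exact Finset.eraseNone.mono
      (Finset.image_subset_image (Finset.range_subset_range.2 (Nat.succ_le_succ hmn)))
  · obtain ⟨n, hn⟩ := hg (some i)
    exact ⟨n, Finset.mem_eraseNone.2
      (Finset.mem_image.2 ⟨n, Finset.mem_range.2 (Nat.lt_succ_self n), hn⟩)⟩

omit [∀ i, TopologicalSpace (E i)] in
/-- Membership in the `J`-cylinder over the compact-generated up-set: `x` lies in
`J.restrict ⁻¹' ↑(J.restrict '' K)` iff some `k ∈ K` satisfies `k i ≤ x i` for all `i ∈ J`. [folklore] -/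
private theorem mem_restrict_preimage_upperClosure {J : Finset ι} {K : Set (∀ i, E i)} {x : ∀ i, E i} :
    x ∈ J.restrict ⁻¹' (upperClosure (J.restrict '' K) : Set (∀ i : ↥J, E i)) ↔
      ∃ k ∈ K, ∀ i (hi : i ∈ J), k i ≤ x i := by
  simp only [mem_preimage, SetLike.mem_coe, mem_upperClosure, mem_image, exists_exists_and_eq_and]
  refine exists_congr fun k => and_congr_right fun _ => ?_
  simp only [Pi.le_def, Subtype.forall]
  rfl

variable [∀ i, OrderClosedTopology (E i)]

/-- The cluster-point step of [GrimmettRandomCluster2006, (4.4)] / [Lindqvist1988, Thm. 5.1]: if along an exhaustion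
`J_n ↑ ι` the point `x` dominates, on each `J_n`, some point of the compact set `K`, then `x` dominates a
point of `K`. [folklore] -/
private theorem mem_upperClosure_of_forall_exhaustion (J : ℕ → Finset ι) (hJ : Monotone J)
    (hex : ∀ i, ∃ n, i ∈ J n) {K : Set (∀ i, E i)} (hK : IsCompact K) {x : ∀ i, E i}
    (hx : ∀ n, ∃ k ∈ K, ∀ i (hi : i ∈ J n), k i ≤ x i) :
    x ∈ (upperClosure K : Set (∀ i, E i)) := by
  choose k hkK hkle using hx
  obtain ⟨a, haK, ha⟩ := hK.exists_mapClusterPt (f := atTop) (u := k)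
    (le_principal_iff.2 (mem_map.2 (Eventually.of_forall hkK)))
  refine mem_upperClosure.2 ⟨a, haK, fun i => ?_⟩
  have hS : IsClosed {ω : ∀ j, E j | ω i ≤ x i} := isClosed_le (continuous_apply i) continuous_const
  obtain ⟨n₀, hn₀⟩ := hex i
  have hev : ∀ᶠ n in atTop, k n ∈ {ω : ∀ j, E j | ω i ≤ x i} :=
    eventually_atTop.2 ⟨n₀, fun n hn => hkle n i (hJ hn hn₀)⟩
  have hcl : ClusterPt a (𝓟 {ω : ∀ j, E j | ω i ≤ x i}) :=
    ha.clusterPt.mono (le_principal_iff.2 (mem_map.2 hev))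
  exact isClosed_iff_clusterPt.mp hS a hcl

variable [∀ i, MeasurableSpace (E i)] [Countable ι] [∀ i, SecondCountableTopology (E i)]

section General

variable [∀ i, OpensMeasurableSpace (E i)]

/-- **Lindqvist's Theorem 5.1 / Last–Szekli–Yogeshwaran's Theorem 3.5 (finite-dimensional marginals
suffice).**  Let `μ` be a finite Borel measure on a countable product `Π i, E i` of second-countable ordered
spaces with closed orders, inner regular by compact sets (automatic when the `E i` are Polish).  If every
finite-dimensional marginal `μ ∘ (J.restrict)⁻¹`, `J ⊂ ι` finite, is positively associated, then `μ` is
positively associated.  Proof [GrimmettRandomCluster2006, (4.4)–(4.5)]: by Thm. 3.1 it suffices to treat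
compact-generated upper sets `↑K₁, ↑K₂`; their `J_n`-cylinders decrease to them along an exhaustion
(`mem_upperClosure_of_forall_exhaustion`), the marginal inequality holds for the cylinders, and finite
measures are continuous along decreasing sequences.
[cite: Lindqvist1988, Thm. 5.1; LastSzekliYogeshwaran2020, Thm. 3.5] -/
theorem isPositivelyAssociated_pi_of_forall_finset (μ : Measure (∀ i, E i)) [IsFiniteMeasure μ]
    [μ.InnerRegularCompactLTTop]
    (h : ∀ J : Finset ι, IsPositivelyAssociated (μ.map J.restrict)) :
    IsPositivelyAssociated μ := by
  classical
  obtain ⟨J, hJmono, hJex⟩ := exists_finset_exhaustion ι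
  refine .of_isCompact μ fun K₁ K₂ hK₁ hK₂ => ?_
  -- the cylinders over the exhaustion
  let cyl : Set (∀ i, E i) → ℕ → Set (∀ i, E i) := fun K n =>
    (J n).restrict ⁻¹' (upperClosure ((J n).restrict '' K) : Set (∀ i : ↥(J n), E i))
  have hcont : ∀ n, Continuous ((J n).restrict : (∀ i, E i) → ∀ i : ↥(J n), E i) := fun n =>
    continuous_pi fun i => continuous_apply _
  have hUc : ∀ n (K : Set (∀ i, E i)), IsCompact K →
      IsClosed (upperClosure ((J n).restrict '' K) : Set (∀ i : ↥(J n), E i)) := fun n K hK =>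
    isClosed_upperClosure_of_isCompact (hK.image (hcont n))
  have hmeas : ∀ n (K : Set (∀ i, E i)), IsCompact K → MeasurableSet (cyl K n) := fun n K hK =>
    (hUc n K hK).measurableSet.preimage (Finset.measurable_restrict _)
  have hanti : ∀ (K : Set (∀ i, E i)), Antitone (cyl K) := by
    intro K m n hmn x hx
    obtain ⟨k, hk, hle⟩ := mem_restrict_preimage_upperClosure.1 hx
    exact mem_restrict_preimage_upperClosure.2 ⟨k, hk, fun i hi => hle i (hJmono hmn hi)⟩
  have hiInter : ∀ (K : Set (∀ i, E i)), IsCompact K →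
      ⋂ n, cyl K n = (upperClosure K : Set (∀ i, E i)) := by
    intro K hK
    apply Subset.antisymm
    · intro x hx
      exact mem_upperClosure_of_forall_exhaustion J hJmono hJex hK fun n =>
        mem_restrict_preimage_upperClosure.1 (mem_iInter.1 hx n)
    · intro x hx
      obtain ⟨k, hk, hle⟩ := mem_upperClosure.1 hx
      exact mem_iInter.2 fun n => mem_restrict_preimage_upperClosure.2 ⟨k, hk, fun i _ => hle i⟩
  -- limits of the cylinder measures
  have hlim : ∀ (K : Set (∀ i, E i)), IsCompact K →
      Tendsto (fun n => μ (cyl K n)) atTop (𝓝 (μ (upperClosure K : Set (∀ i, E i)))) := by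
    intro K hK
    have := tendsto_measure_iInter_atTop (μ := μ) (s := cyl K)
      (fun n => (hmeas n K hK).nullMeasurableSet) (hanti K) ⟨0, measure_ne_top μ _⟩
    rwa [hiInter K hK] at this
  have hlim₁₂ : Tendsto (fun n => μ (cyl K₁ n ∩ cyl K₂ n)) atTop
      (𝓝 (μ ((upperClosure K₁ : Set (∀ i, E i)) ∩ (upperClosure K₂ : Set (∀ i, E i))))) := by
    have hanti' : Antitone fun n => cyl K₁ n ∩ cyl K₂ n := fun m n hmn =>
      inter_subset_inter (hanti K₁ hmn) (hanti K₂ hmn)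
    have := tendsto_measure_iInter_atTop (μ := μ) (s := fun n => cyl K₁ n ∩ cyl K₂ n)
      (fun n => ((hmeas n K₁ hK₁).inter (hmeas n K₂ hK₂)).nullMeasurableSet) hanti'
      ⟨0, measure_ne_top μ _⟩
    rwa [iInter_inter_distrib, hiInter K₁ hK₁, hiInter K₂ hK₂] at this
  -- the marginal inequality on each cylinder
  have hineq : ∀ n, μ (cyl K₁ n) * μ (cyl K₂ n) ≤ μ (cyl K₁ n ∩ cyl K₂ n) := by
    intro n
    have hU := (hUc n K₁ hK₁).measurableSet
    have hV := (hUc n K₂ hK₂).measurableSet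
    have key := h (J n) _ _ (upperClosure ((J n).restrict '' K₁)).upper
      (upperClosure ((J n).restrict '' K₂)).upper hU hV
    rwa [map_apply (Finset.measurable_restrict _) hU, map_apply (Finset.measurable_restrict _) hV,
      map_apply (Finset.measurable_restrict _) (hU.inter hV)] at key
  exact le_of_tendsto_of_tendsto'
    (ENNReal.Tendsto.mul (hlim K₁ hK₁) (Or.inr (measure_ne_top μ _)) (hlim K₂ hK₂)
      (Or.inr (measure_ne_top μ _))) hlim₁₂ hineq

/-- **Positive association of a measure on a countable product ⟺ positive association of all its
finite-dimensional marginals** [Lindqvist1988, Thm. 5.1; LastSzekliYogeshwaran2020, Thm. 3.5]; the easy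
direction is closure under the monotone measurable maps `J.restrict` (`IsPositivelyAssociated.map`).
[cite: Lindqvist1988, Thm. 5.1] -/
theorem isPositivelyAssociated_pi_iff_forall_finset (μ : Measure (∀ i, E i)) [IsFiniteMeasure μ]
    [μ.InnerRegularCompactLTTop] :
    IsPositivelyAssociated μ ↔ ∀ J : Finset ι, IsPositivelyAssociated (μ.map J.restrict) :=
  ⟨fun hμ J => hμ.map (fun _ _ hxy i => hxy i) (Finset.measurable_restrict J),
    isPositivelyAssociated_pi_of_forall_finset μ⟩

/-- Cylinder form of Lindqvist's Theorem 5.1: it suffices that `μ(π_J⁻¹ U) μ(π_J⁻¹ V) ≤ μ(π_J⁻¹(U ∩ V))` for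
all finite `J ⊂ ι` and measurable upper sets `U, V` of the finite product `Π i : J, E i` (i.e. for all pairs
of *local* increasing events). [cite: Lindqvist1988, Thm. 5.1; LastSzekliYogeshwaran2020, Thm. 3.5] -/
theorem isPositivelyAssociated_pi_of_cylinders (μ : Measure (∀ i, E i)) [IsFiniteMeasure μ]
    [μ.InnerRegularCompactLTTop]
    (h : ∀ (J : Finset ι) (U V : Set (∀ i : ↥J, E i)), IsUpperSet U → IsUpperSet V →
      MeasurableSet U → MeasurableSet V →
        μ (J.restrict ⁻¹' U) * μ (J.restrict ⁻¹' V) ≤ μ (J.restrict ⁻¹' (U ∩ V))) :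
    IsPositivelyAssociated μ := by
  refine isPositivelyAssociated_pi_of_forall_finset μ fun J U V hU hV hUm hVm => ?_
  rw [map_apply (Finset.measurable_restrict _) hUm, map_apply (Finset.measurable_restrict _) hVm,
    map_apply (Finset.measurable_restrict _) (hUm.inter hVm)]
  exact h J U V hU hV hUm hVm

/-! ### Limits (Lindqvist Thm 3.5 / LSY Thm 3.7 / Grimmett Prop 4.10(b)) -/

/-- **Limits of positively associated measures are positively associated** (convergence on local
events).  On a countable product as above: if `μs k (π_J⁻¹ U) → μ (π_J⁻¹ U)` along a filter for every finite
`J` and every measurable `U ⊆ Π i : J, E i`, and every `μs k` is positively associated, then the finite,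
compact-inner-regular limit `μ` is positively associated.  (For finite spin spaces this hypothesis *is* weak
convergence: `isPositivelyAssociated_pi_of_tendsto_probabilityMeasure`.)
[cite: GrimmettRandomCluster2006, Prop. 4.10(b); Lindqvist1988, Thm. 3.5; LastSzekliYogeshwaran2020, Thm. 3.7] -/
theorem isPositivelyAssociated_pi_of_tendsto {β : Type*} {l : Filter β} [l.NeBot]
    (μs : β → Measure (∀ i, E i)) (μ : Measure (∀ i, E i)) [IsFiniteMeasure μ]
    [μ.InnerRegularCompactLTTop] (hPA : ∀ k, IsPositivelyAssociated (μs k))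
    (hconv : ∀ (J : Finset ι) (U : Set (∀ i : ↥J, E i)), MeasurableSet U →
      Tendsto (fun k => μs k (J.restrict ⁻¹' U)) l (𝓝 (μ (J.restrict ⁻¹' U)))) :
    IsPositivelyAssociated μ := by
  refine isPositivelyAssociated_pi_of_cylinders μ fun J U V hU hV hUm hVm => ?_
  have h₁ := hconv J U hUm
  have h₂ := hconv J V hVm
  have h₃ := hconv J (U ∩ V) (hUm.inter hVm)
  refine le_of_tendsto_of_tendsto'
    (ENNReal.Tendsto.mul h₁ (Or.inr (measure_ne_top μ _)) h₂ (Or.inr (measure_ne_top μ _))) h₃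
    fun k => ?_
  exact hPA k _ _ (hU.preimage fun _ _ hxy i => hxy i) (hV.preimage fun _ _ hxy i => hxy i)
    (hUm.preimage (Finset.measurable_restrict _)) (hVm.preimage (Finset.measurable_restrict _))

end General

section Discrete

variable [∀ i, DiscreteTopology (E i)] [∀ i, BorelSpace (E i)]

/-- **Weak limits of positively associated probability measures on a countable product of discrete
ordered spaces are positively associated** — the form used for infinite-volume limits on `{0,1}^E`
[GrimmettRandomCluster2006, Prop. 4.10(b)], here for any countable discrete ordered factors (`Bool`, `Fin q`, `ℕ`,
…): cylinder events are clopen, so the portmanteau theorem turns weak convergence into convergence on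
every local event. [cite: GrimmettRandomCluster2006, Prop. 4.10(b); LastSzekliYogeshwaran2020, Thm. 3.7] -/
theorem isPositivelyAssociated_pi_of_tendsto_probabilityMeasure {β : Type*} {l : Filter β} [l.NeBot] {μs : β → ProbabilityMeasure (∀ i, E i)}
    {μ : ProbabilityMeasure (∀ i, E i)} (hlim : Tendsto μs l (𝓝 μ))
    (hPA : ∀ k, IsPositivelyAssociated (μs k : Measure (∀ i, E i))) :
    IsPositivelyAssociated (μ : Measure (∀ i, E i)) := by
  classical
  haveI : (μ : Measure (∀ i, E i)).InnerRegularCompactLTTop := inferInstance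
  haveI : HasOuterApproxClosed (∀ i, E i) := by
    letI : PseudoMetricSpace (∀ i, E i) := TopologicalSpace.pseudoMetrizableSpacePseudoMetric _
    infer_instance
  refine isPositivelyAssociated_pi_of_tendsto (l := l) (fun k => (μs k : Measure (∀ i, E i))) μ hPA
    fun J U _ => ?_
  have hcont : Continuous (J.restrict : (∀ i, E i) → ∀ i : ↥J, E i) :=
    continuous_pi fun i => continuous_apply _
  have hclopen : IsClopen (J.restrict ⁻¹' U) := (isClopen_discrete U).preimage hcont
  have hnull : μ (frontier (J.restrict ⁻¹' U)) = 0 := by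
    rw [hclopen.frontier_eq]
    simp
  have key := ProbabilityMeasure.tendsto_measure_of_null_frontier_of_tendsto hlim hnull
  have key' := (ENNReal.tendsto_coe.2 key)
  simp only [ProbabilityMeasure.ennreal_coeFn_eq_coeFn_toMeasure] at key'
  exact key'

/-! ### Continuous monotone functions suffice (LSY Lemma 3.6) on products of discrete ordered spaces -/

/-- **Continuous monotone test functions suffice** [LastSzekliYogeshwaran2020, Lemma 3.6;
Lindqvist1988, Thm. 3.1 (v)]: on a countable product of discrete ordered spaces, a probability measure with
`(∫ f dμ)(∫ g dμ) ≤ ∫ f g dμ` for all *continuous* monotone `f, g` with values in `[0,1]` is positively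
associated — hence (tree: `IsPositivelyAssociated.integral_mul_integral_le_integral_mul`) satisfies the
inequality for all bounded *measurable* monotone `f, g`, and for all measurable increasing events of the
whole configuration, not only local ones.  Proof: indicators of cylinder up-sets are continuous and
monotone; then Lindqvist's Theorem 5.1.
[cite: LastSzekliYogeshwaran2020, Lemma 3.6; Lindqvist1988, Thm. 3.1 ((v) ⇒ (i)); GrimmettRandomCluster2006, (4.8)–(4.9)] -/
theorem IsPositivelyAssociated.of_continuous_pi (μ : Measure (∀ i, E i)) [IsProbabilityMeasure μ]
    (h : ∀ f g : (∀ i, E i) → ℝ, Continuous f → Continuous g → Monotone f → Monotone g →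
      (∀ x, 0 ≤ f x) → (∀ x, f x ≤ 1) → (∀ x, 0 ≤ g x) → (∀ x, g x ≤ 1) →
        (∫ x, f x ∂μ) * (∫ x, g x ∂μ) ≤ ∫ x, f x * g x ∂μ) :
    IsPositivelyAssociated μ := by
  classical
  refine isPositivelyAssociated_pi_of_cylinders μ fun J U V hU hV hUm hVm => ?_
  have hcont : Continuous (J.restrict : (∀ i, E i) → ∀ i : ↥J, E i) :=
    continuous_pi fun i => continuous_apply _
  -- indicators of the (clopen, increasing) cylinders
  set C₁ := J.restrict ⁻¹' U with hC₁
  set C₂ := J.restrict ⁻¹' V with hC₂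
  have hcl₁ : IsClopen C₁ := (isClopen_discrete U).preimage hcont
  have hcl₂ : IsClopen C₂ := (isClopen_discrete V).preimage hcont
  have hm₁ : MeasurableSet C₁ := hUm.preimage (Finset.measurable_restrict _)
  have hm₂ : MeasurableSet C₂ := hVm.preimage (Finset.measurable_restrict _)
  have hup₁ : IsUpperSet C₁ := hU.preimage fun _ _ hxy i => hxy i
  have hup₂ : IsUpperSet C₂ := hV.preimage fun _ _ hxy i => hxy i
  -- continuity of the indicator of a clopen set
  have hind_cont : ∀ {C : Set (∀ i, E i)}, IsClopen C →
      Continuous (C.indicator (1 : (∀ i, E i) → ℝ)) := by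
    intro C hC
    have h1 : C.indicator (1 : (∀ i, E i) → ℝ) =
        (fun b : Bool => if b then (1 : ℝ) else 0) ∘ C.boolIndicator := by
      funext x
      by_cases hx : x ∈ C <;> simp [Set.boolIndicator, hx]
    rw [h1]
    exact continuous_of_discreteTopology.comp ((continuous_boolIndicator_iff_isClopen C).2 hC)
  have hind_mono : ∀ {C : Set (∀ i, E i)}, IsUpperSet C →
      Monotone (C.indicator (1 : (∀ i, E i) → ℝ)) := by
    intro C hC x y hxy
    by_cases hx : x ∈ C
    · simp [hx, hC hxy hx]
    · by_cases hy : y ∈ C <;> simp [hx, hy]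
  have hind_nn : ∀ (C : Set (∀ i, E i)) x, 0 ≤ C.indicator (1 : (∀ i, E i) → ℝ) x := fun C x =>
    Set.indicator_nonneg (fun _ _ => zero_le_one) x
  have hind_le : ∀ (C : Set (∀ i, E i)) x, C.indicator (1 : (∀ i, E i) → ℝ) x ≤ 1 := fun C x =>
    Set.indicator_apply_le' (fun _ => le_rfl) (fun _ => zero_le_one)
  have key := h _ _ (hind_cont hcl₁) (hind_cont hcl₂) (hind_mono hup₁) (hind_mono hup₂)
    (hind_nn C₁) (hind_le C₁) (hind_nn C₂) (hind_le C₂)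
  -- translate integrals of indicators into measures
  have hprod : (fun x => C₁.indicator (1 : (∀ i, E i) → ℝ) x * C₂.indicator (1 : (∀ i, E i) → ℝ) x) =
      fun x => (C₁ ∩ C₂).indicator (1 : (∀ i, E i) → ℝ) x := by
    funext x
    rw [Set.inter_indicator_one]
    rfl
  rw [hprod, integral_indicator_one hm₁, integral_indicator_one hm₂,
    integral_indicator_one (hm₁.inter hm₂)] at key
  -- back to `ℝ≥0∞`
  have hfin : μ C₁ * μ C₂ ≠ ∞ := ENNReal.mul_ne_top (measure_ne_top μ _) (measure_ne_top μ _)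
  rw [show J.restrict ⁻¹' (U ∩ V) = C₁ ∩ C₂ from rfl,
    ← ENNReal.toReal_le_toReal hfin (measure_ne_top μ _), ENNReal.toReal_mul]
  simpa only [measureReal_def] using key

end Discrete

end Product

/-! ### Two-valued spins `ι → Bool` -/

section Spins

variable {ι : Type*} [Countable ι]

/-- **Two-valued spin configurations**: a finite measure on `{0,1}^ι` (`ι` countable, `false < true`,
coordinatewise order) is positively associated iff all its finite-dimensional marginals are; in
particular positive association of all *cylinder* (local) increasing events gives it for *all* measurable
increasing events of the infinite configuration. [cite: Lindqvist1988, Thm. 5.1; GrimmettRandomCluster2006, (4.4)–(4.9)] -/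
theorem isPositivelyAssociated_spins_iff_forall_finset (μ : Measure (ι → Bool)) [IsFiniteMeasure μ] :
    IsPositivelyAssociated μ ↔
      ∀ J : Finset ι, IsPositivelyAssociated (μ.map (J.restrict (π := fun _ => Bool))) := by
  exact isPositivelyAssociated_pi_iff_forall_finset (E := fun _ : ι => Bool) μ

/-- **Weak limits on `{0,1}^ι`** [GrimmettRandomCluster2006, Prop. 4.10(b)]: if probability measures `μs k` on the
spin space `ι → Bool` (`ι` countable) converge weakly to `μ` and each `μs k` is positively associated, then
`μ` is positively associated — e.g. every infinite-volume limit of finite-volume FKG (lattice-condition)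
measures. [cite: GrimmettRandomCluster2006, Prop. 4.10(b); LastSzekliYogeshwaran2020, Thm. 3.7] -/
theorem isPositivelyAssociated_spins_of_tendsto {β : Type*} {l : Filter β} [l.NeBot]
    {μs : β → ProbabilityMeasure (ι → Bool)} {μ : ProbabilityMeasure (ι → Bool)}
    (hlim : Tendsto μs l (𝓝 μ)) (hPA : ∀ k, IsPositivelyAssociated (μs k : Measure (ι → Bool))) :
    IsPositivelyAssociated (μ : Measure (ι → Bool)) := by
  exact isPositivelyAssociated_pi_of_tendsto_probabilityMeasure (E := fun _ : ι => Bool) hlim hPA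

/-- **Continuous monotone functionals suffice on `{0,1}^ι`** [LastSzekliYogeshwaran2020, Lemma 3.6]:
positive correlation of all continuous (in particular of all local) monotone `[0,1]`-valued functionals
implies positive association, i.e. the FKG inequality for all bounded measurable monotone functionals of
the infinite configuration. [cite: LastSzekliYogeshwaran2020, Lemma 3.6; Lindqvist1988, Thm. 3.1] -/
theorem isPositivelyAssociated_spins_of_continuous (μ : Measure (ι → Bool)) [IsProbabilityMeasure μ]
    (h : ∀ f g : (ι → Bool) → ℝ, Continuous f → Continuous g → Monotone f → Monotone g →
      (∀ x, 0 ≤ f x) → (∀ x, f x ≤ 1) → (∀ x, 0 ≤ g x) → (∀ x, g x ≤ 1) →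
        (∫ x, f x ∂μ) * (∫ x, g x ∂μ) ≤ ∫ x, f x * g x ∂μ) :
    IsPositivelyAssociated μ := by
  exact IsPositivelyAssociated.of_continuous_pi (E := fun _ : ι => Bool) μ h

end Spins

/-! ### Products of metric chains (`ι → ℝ`, `ι → [0,1]`): continuous monotone test functions; weak limits -/

section MetricChains

variable {ι : Type*} {E : ι → Type*} [∀ i, LinearOrder (E i)] [∀ i, PseudoMetricSpace (E i)]

/-- In a finite sup-metric product of chains whose distance is compatible with `max`
(`dist a (a ⊔ b) ≤ dist c b` for `c ≤ a` — Rüschendorf's condition (R1) on the factors), the distance to an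
increasing set is non-increasing: `x ≤ y ⇒ d(y, C) ≤ d(x, C)` [Lindqvist1988, §2, (R1)]. [folklore] -/
private theorem infDist_anti_of_isUpperSet {κ : Type*} [Fintype κ] {F : κ → Type*}
    [∀ k, LinearOrder (F k)] [∀ k, PseudoMetricSpace (F k)]
    (hF : ∀ k (a b c : F k), c ≤ a → dist a (a ⊔ b) ≤ dist c b)
    {C : Set (∀ k, F k)} (hC : IsUpperSet C) {x y : ∀ k, F k} (hxy : x ≤ y) :
    Metric.infDist y C ≤ Metric.infDist x C := by
  rcases C.eq_empty_or_nonempty with rfl | hne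
  · simp [Metric.infDist_empty]
  refine le_of_forall_pos_lt_add fun ε hε => ?_
  obtain ⟨z, hzC, hz⟩ := (Metric.infDist_lt_iff hne).1 (lt_add_of_pos_right (Metric.infDist x C) hε)
  have hyz : y ⊔ z ∈ C := hC le_sup_right hzC
  calc Metric.infDist y C ≤ dist y (y ⊔ z) := Metric.infDist_le_dist_of_mem hyz
    _ ≤ dist x z := by
        refine (dist_pi_le_iff dist_nonneg).2 fun k => ?_
        rw [Pi.sup_apply]
        exact (hF k (y k) (z k) (x k) (hxy k)).trans (dist_le_pi_dist x z k)
    _ < Metric.infDist x C + ε := hz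

/-- The continuous monotone approximants `max (0, 1 − m·d(x, C))` of the indicator of an up-set. [folklore] -/
private def upApprox {X : Type*} [PseudoMetricSpace X] (C : Set X) (m : ℕ) (x : X) : ℝ :=
  max 0 (1 - m * Metric.infDist x C)

/-- Continuity of the approximants. [folklore] -/
private theorem upApprox_continuous {X : Type*} [PseudoMetricSpace X] (C : Set X) (m : ℕ) :
    Continuous (upApprox C m) :=
  continuous_const.max (continuous_const.sub (continuous_const.mul (Metric.continuous_infDist_pt C)))

/-- The approximants are nonnegative. [folklore] -/
private theorem upApprox_nonneg {X : Type*} [PseudoMetricSpace X] (C : Set X) (m : ℕ) (x : X) :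
    0 ≤ upApprox C m x := le_max_left _ _

/-- The approximants are at most `1`. [folklore] -/
private theorem upApprox_le_one {X : Type*} [PseudoMetricSpace X] (C : Set X) (m : ℕ) (x : X) :
    upApprox C m x ≤ 1 :=
  max_le zero_le_one (sub_le_self _ (mul_nonneg (Nat.cast_nonneg m) Metric.infDist_nonneg))

/-- The approximants equal `1` on the set. [folklore] -/
private theorem upApprox_of_mem {X : Type*} [PseudoMetricSpace X] {C : Set X} (m : ℕ) {x : X}
    (hx : x ∈ C) : upApprox C m x = 1 := by
  simp [upApprox, Metric.infDist_zero_of_mem hx]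

/-- Pointwise convergence of the approximants to the indicator of a nonempty closed set. [folklore] -/
private theorem tendsto_upApprox {X : Type*} [PseudoMetricSpace X] {C : Set X} (hC : IsClosed C)
    (hne : C.Nonempty) (x : X) :
    Tendsto (fun m => upApprox C m x) atTop (𝓝 (C.indicator (1 : X → ℝ) x)) := by
  by_cases hx : x ∈ C
  · simp only [upApprox_of_mem _ hx, Set.indicator_of_mem hx, Pi.one_apply]
    exact tendsto_const_nhds
  · rw [Set.indicator_of_notMem hx]
    have hd : 0 < Metric.infDist x C := by
      have hx' : x ∉ closure C := by rwa [hC.closure_eq]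
      have h0 : Metric.infDist x C ≠ 0 := fun h =>
        hx' ((Metric.mem_closure_iff_infDist_zero hne).2 h)
      exact lt_of_le_of_ne Metric.infDist_nonneg (Ne.symm h0)
    refine tendsto_atTop_of_eventually_const (i₀ := ⌈(Metric.infDist x C)⁻¹⌉₊) fun m hm => ?_
    have hm' : (Metric.infDist x C)⁻¹ ≤ m := (Nat.le_ceil _).trans (by exact_mod_cast hm)
    have h1 : 1 ≤ m * Metric.infDist x C := by
      have := mul_le_mul_of_nonneg_right hm' hd.le
      rwa [inv_mul_cancel₀ hd.ne'] at this
    simp only [upApprox]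
    exact max_eq_left (by linarith)

/-- Monotonicity of the approximants of an increasing set in a product of (R1) metric chains. [folklore] -/
private theorem upApprox_mono {κ : Type*} [Fintype κ] {F : κ → Type*}
    [∀ k, LinearOrder (F k)] [∀ k, PseudoMetricSpace (F k)]
    (hF : ∀ k (a b c : F k), c ≤ a → dist a (a ⊔ b) ≤ dist c b)
    {C : Set (∀ k, F k)} (hC : IsUpperSet C) (m : ℕ) : Monotone (upApprox C m) := by
  intro x y hxy
  refine max_le_max le_rfl (sub_le_sub_left ?_ 1)
  exact mul_le_mul_of_nonneg_left (infDist_anti_of_isUpperSet hF hC hxy) (Nat.cast_nonneg m)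

/-- `dist a (a ⊔ b) ≤ dist c b` for `c ≤ a` in `ℝ` (Rüschendorf's (R1) for the real line). [folklore] -/
private theorem real_dist_sup_le (a b c : ℝ) (h : c ≤ a) : dist a (a ⊔ b) ≤ dist c b := by
  rcases le_total b a with hba | hab
  · rw [sup_eq_left.2 hba, dist_self]
    exact dist_nonneg
  · rw [sup_eq_right.2 hab, Real.dist_eq, Real.dist_eq, abs_of_nonpos (by linarith),
      abs_of_nonpos (by linarith)]
    linarith

/-- The same for any subset of `ℝ` with the induced order and metric (e.g. `[0,1]`). [folklore] -/
private theorem subtype_dist_sup_le {p : ℝ → Prop} (a b c : {x : ℝ // p x}) (h : c ≤ a) :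
    dist a (a ⊔ b) ≤ dist c b := by
  rcases le_total b a with hba | hab
  · rw [sup_eq_left.2 hba, dist_self]
    exact dist_nonneg
  · have hca : (c : ℝ) ≤ a := h
    have hab' : (a : ℝ) ≤ b := hab
    rw [sup_eq_right.2 hab, Subtype.dist_eq, Subtype.dist_eq, Real.dist_eq, Real.dist_eq,
      abs_of_nonpos (by linarith), abs_of_nonpos (by linarith)]
    linarith

variable [∀ i, OrderClosedTopology (E i)] [∀ i, MeasurableSpace (E i)] [∀ i, BorelSpace (E i)]
  [∀ i, SecondCountableTopology (E i)] [∀ i, TopologicalSpace.IsCompletelyPseudoMetrizableSpace (E i)]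
  [Countable ι]

/-- **Continuous monotone test functions suffice on a countable product of metric chains**
[LastSzekliYogeshwaran2020, Lemma 3.6; Lindqvist1988, Thm. 3.1 (v) ⇒ (i)].  Let the factors `E i` be
complete separable linearly ordered (pseudo)metric spaces with closed order whose distance is compatible
with `max` (`dist a (a ⊔ b) ≤ dist c b` for `c ≤ a`; e.g. `ℝ`, `[0,1]`, any subset of `ℝ`).  If a probability
measure `μ` on `Π i, E i` satisfies `(∫ f dμ)(∫ g dμ) ≤ ∫ f g dμ` for all *continuous* monotone `f, g` with values
in `[0,1]`, then `μ` is positively associated (hence the inequality holds for all bounded measurable monotone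
`f, g`).  Proof: the indicator of a closed increasing subset `C` of a finite-dimensional marginal space is the
decreasing limit of the continuous monotone `max(0, 1 − m·d(·, C))` (distance antitone by (R1)); dominated
convergence gives the inequality for closed increasing cylinder events, Theorem 3.1 gives the marginals,
Theorem 5.1 the whole product.
[cite: LastSzekliYogeshwaran2020, Lemma 3.6; Lindqvist1988, Thm. 3.1 ((v) ⇒ (i)) and §2 (R1)] -/
theorem IsPositivelyAssociated.of_continuous_pi_of_dist
    (hE : ∀ i (a b c : E i), c ≤ a → dist a (a ⊔ b) ≤ dist c b)
    (μ : Measure (∀ i, E i)) [IsProbabilityMeasure μ]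
    (h : ∀ f g : (∀ i, E i) → ℝ, Continuous f → Continuous g → Monotone f → Monotone g →
      (∀ x, 0 ≤ f x) → (∀ x, f x ≤ 1) → (∀ x, 0 ≤ g x) → (∀ x, g x ≤ 1) →
        (∫ x, f x ∂μ) * (∫ x, g x ∂μ) ≤ ∫ x, f x * g x ∂μ) :
    IsPositivelyAssociated μ := by
  classical
  refine isPositivelyAssociated_pi_of_forall_finset μ fun J => ?_
  haveI : IsFiniteMeasure (μ.map J.restrict) := inferInstance
  refine IsPositivelyAssociated.of_isClosed (μ.map J.restrict) fun C₁ C₂ hc₁ hc₂ hu₁ hu₂ => ?_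
  have hπm : Measurable (J.restrict : (∀ i, E i) → ∀ i : ↥J, E i) := Finset.measurable_restrict _
  have hπc : Continuous (J.restrict : (∀ i, E i) → ∀ i : ↥J, E i) :=
    continuous_pi fun i => continuous_apply _
  have hπmono : Monotone (J.restrict : (∀ i, E i) → ∀ i : ↥J, E i) := fun _ _ hxy i => hxy i
  rw [map_apply hπm hc₁.measurableSet, map_apply hπm hc₂.measurableSet,
    map_apply hπm (hc₁.measurableSet.inter hc₂.measurableSet)]
  -- empty sets: nothing to prove
  rcases C₁.eq_empty_or_nonempty with rfl | hne₁
  · simp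
  rcases C₂.eq_empty_or_nonempty with rfl | hne₂
  · simp
  -- the continuous monotone approximants of the two cylinder indicators
  have hF : ∀ (k : ↥J) (a b c : E k), c ≤ a → dist a (a ⊔ b) ≤ dist c b := fun k => hE k
  set f : ℕ → (∀ i, E i) → ℝ := fun m x => upApprox C₁ m (J.restrict x) with hfdef
  set g : ℕ → (∀ i, E i) → ℝ := fun m x => upApprox C₂ m (J.restrict x) with hgdef
  have key : ∀ m, (∫ x, f m x ∂μ) * (∫ x, g m x ∂μ) ≤ ∫ x, f m x * g m x ∂μ := fun m =>
    h (f m) (g m) ((upApprox_continuous C₁ m).comp hπc) ((upApprox_continuous C₂ m).comp hπc)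
      ((upApprox_mono hF hu₁ m).comp hπmono) ((upApprox_mono hF hu₂ m).comp hπmono)
      (fun x => upApprox_nonneg C₁ m _) (fun x => upApprox_le_one C₁ m _)
      (fun x => upApprox_nonneg C₂ m _) (fun x => upApprox_le_one C₂ m _)
  -- dominated convergence: the three integrals converge to the measures of the cylinders
  set A₁ : Set (∀ i, E i) := J.restrict ⁻¹' C₁ with hA₁
  set A₂ : Set (∀ i, E i) := J.restrict ⁻¹' C₂ with hA₂
  have hA₁m : MeasurableSet A₁ := hc₁.measurableSet.preimage hπm
  have hA₂m : MeasurableSet A₂ := hc₂.measurableSet.preimage hπm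
  have hlimf : ∀ x, Tendsto (fun m => f m x) atTop (𝓝 (A₁.indicator (1 : (∀ i, E i) → ℝ) x)) := by
    intro x
    have := tendsto_upApprox hc₁ hne₁ (J.restrict x)
    simp only [Set.indicator_apply, Set.mem_preimage, Pi.one_apply, A₁] at this ⊢
    exact this
  have hlimg : ∀ x, Tendsto (fun m => g m x) atTop (𝓝 (A₂.indicator (1 : (∀ i, E i) → ℝ) x)) := by
    intro x
    have := tendsto_upApprox hc₂ hne₂ (J.restrict x)
    simp only [Set.indicator_apply, Set.mem_preimage, Pi.one_apply, A₂] at this ⊢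
    exact this
  have hbound : ∀ (u : ℕ → (∀ i, E i) → ℝ), (∀ m x, 0 ≤ u m x) → (∀ m x, u m x ≤ 1) →
      ∀ m, ∀ᵐ x ∂μ, ‖u m x‖ ≤ (1 : ℝ) := fun u h0 h1 m =>
    Eventually.of_forall fun x => by
      rw [Real.norm_eq_abs, abs_of_nonneg (h0 m x)]
      exact h1 m x
  have hIf : Tendsto (fun m => ∫ x, f m x ∂μ) atTop (𝓝 (μ.real A₁)) := by
    rw [← integral_indicator_one hA₁m]
    exact tendsto_integral_of_dominated_convergence (fun _ => (1 : ℝ))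
      (fun m => (((upApprox_continuous C₁ m).comp hπc).measurable).aestronglyMeasurable)
      (integrable_const 1) (hbound f (fun m x => upApprox_nonneg C₁ m _) fun m x => upApprox_le_one C₁ m _)
      (Eventually.of_forall hlimf)
  have hIg : Tendsto (fun m => ∫ x, g m x ∂μ) atTop (𝓝 (μ.real A₂)) := by
    rw [← integral_indicator_one hA₂m]
    exact tendsto_integral_of_dominated_convergence (fun _ => (1 : ℝ))
      (fun m => (((upApprox_continuous C₂ m).comp hπc).measurable).aestronglyMeasurable)
      (integrable_const 1) (hbound g (fun m x => upApprox_nonneg C₂ m _) fun m x => upApprox_le_one C₂ m _)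
      (Eventually.of_forall hlimg)
  have hIfg : Tendsto (fun m => ∫ x, f m x * g m x ∂μ) atTop (𝓝 (μ.real (A₁ ∩ A₂))) := by
    rw [← integral_indicator_one (hA₁m.inter hA₂m)]
    refine tendsto_integral_of_dominated_convergence (fun _ => (1 : ℝ))
      (fun m => ((((upApprox_continuous C₁ m).comp hπc).mul
        ((upApprox_continuous C₂ m).comp hπc)).measurable).aestronglyMeasurable)
      (integrable_const 1) (hbound (fun m x => f m x * g m x)
        (fun m x => mul_nonneg (upApprox_nonneg C₁ m _) (upApprox_nonneg C₂ m _))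
        (fun m x => mul_le_one₀ (upApprox_le_one C₁ m _) (upApprox_nonneg C₂ m _)
          (upApprox_le_one C₂ m _)))
      (Eventually.of_forall fun x => ?_)
    have hprod : (A₁ ∩ A₂).indicator (1 : (∀ i, E i) → ℝ) x =
        A₁.indicator (1 : (∀ i, E i) → ℝ) x * A₂.indicator (1 : (∀ i, E i) → ℝ) x := by
      rw [Set.inter_indicator_one]
      rfl
    rw [hprod]
    exact (hlimf x).mul (hlimg x)
  have hreal : μ.real A₁ * μ.real A₂ ≤ μ.real (A₁ ∩ A₂) :=
    le_of_tendsto_of_tendsto' (hIf.mul hIg) hIfg key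
  -- back to `ℝ≥0∞`
  have hfin : μ A₁ * μ A₂ ≠ ∞ := ENNReal.mul_ne_top (measure_ne_top μ _) (measure_ne_top μ _)
  rw [show J.restrict ⁻¹' (C₁ ∩ C₂) = A₁ ∩ A₂ from rfl,
    ← ENNReal.toReal_le_toReal hfin (measure_ne_top μ _), ENNReal.toReal_mul]
  simpa only [measureReal_def] using hreal

/-- **Weak limits of positively associated probability measures on countable products of metric chains are
positively associated** [Lindqvist1988, Thm. 3.5; LastSzekliYogeshwaran2020, Thm. 3.7] — factors as in
`IsPositivelyAssociated.of_continuous_pi_of_dist` (`ℝ`, `[0,1]`, …): the covariance inequality for bounded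
continuous monotone functions passes to weak limits, and continuous test functions suffice.
[cite: Lindqvist1988, Thm. 3.5; LastSzekliYogeshwaran2020, Thm. 3.7] -/
theorem isPositivelyAssociated_pi_of_tendsto_probabilityMeasure_of_dist
    (hE : ∀ i (a b c : E i), c ≤ a → dist a (a ⊔ b) ≤ dist c b)
    {β : Type*} {l : Filter β} [l.NeBot] {μs : β → ProbabilityMeasure (∀ i, E i)}
    {μ : ProbabilityMeasure (∀ i, E i)} (hlim : Tendsto μs l (𝓝 μ))
    (hPA : ∀ k, IsPositivelyAssociated (μs k : Measure (∀ i, E i))) :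
    IsPositivelyAssociated (μ : Measure (∀ i, E i)) := by
  refine IsPositivelyAssociated.of_continuous_pi_of_dist hE μ
    fun f g hf hg hfm hgm hf0 hf1 hg0 hg1 => ?_
  -- bounded continuous packaging of `f`, `g`, `f g`
  have hdist : ∀ (u : (∀ i, E i) → ℝ), (∀ x, 0 ≤ u x) → (∀ x, u x ≤ 1) →
      ∀ x y, dist (u x) (u y) ≤ 1 := fun u h0 h1 x y => by
    rw [Real.dist_eq]
    exact abs_sub_le_iff.2 ⟨by linarith [h0 y, h1 x], by linarith [h0 x, h1 y]⟩
  have hfg : Continuous fun x => f x * g x := hf.mul hg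
  let fB : BoundedContinuousFunction (∀ i, E i) ℝ := BoundedContinuousFunction.mkOfBound ⟨f, hf⟩ 1 (hdist f hf0 hf1)
  let gB : BoundedContinuousFunction (∀ i, E i) ℝ := BoundedContinuousFunction.mkOfBound ⟨g, hg⟩ 1 (hdist g hg0 hg1)
  let fgB : BoundedContinuousFunction (∀ i, E i) ℝ := BoundedContinuousFunction.mkOfBound ⟨fun x => f x * g x, hfg⟩ 1
    (hdist (fun x => f x * g x) (fun x => mul_nonneg (hf0 x) (hg0 x))
      (fun x => mul_le_one₀ (hf1 x) (hg0 x) (hg1 x)))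
  have hw := ProbabilityMeasure.tendsto_iff_forall_integral_tendsto.1 hlim
  have Tf : Tendsto (fun k => ∫ x, f x ∂(μs k : Measure (∀ i, E i))) l
      (𝓝 (∫ x, f x ∂(μ : Measure (∀ i, E i)))) := hw fB
  have Tg : Tendsto (fun k => ∫ x, g x ∂(μs k : Measure (∀ i, E i))) l
      (𝓝 (∫ x, g x ∂(μ : Measure (∀ i, E i)))) := hw gB
  have Tfg : Tendsto (fun k => ∫ x, f x * g x ∂(μs k : Measure (∀ i, E i))) l
      (𝓝 (∫ x, f x * g x ∂(μ : Measure (∀ i, E i)))) := hw fgB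
  refine le_of_tendsto_of_tendsto' (Tf.mul Tg) Tfg fun k => ?_
  exact (hPA k).integral_mul_integral_le_integral_mul hfm hgm hf.measurable hg.measurable
    ⟨1, fun x => by rw [abs_of_nonneg (hf0 x)]; exact hf1 x⟩
    ⟨1, fun x => by rw [abs_of_nonneg (hg0 x)]; exact hg1 x⟩

end MetricChains

/-! ### Real-valued fields `ι → ℝ` and the Hilbert cube `ι → [0,1]` -/

section RealFields

variable {ι : Type*} [Countable ι]

/-- **Lattice fields `ι → ℝ`: continuous monotone test functions suffice** [LastSzekliYogeshwaran2020,
Lemma 3.6]: a probability measure on `ℝ^ι` (`ι` countable) with `(∫ f)(∫ g) ≤ ∫ f g` for all continuous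
monotone `[0,1]`-valued `f, g` is positively associated (FKG for all bounded measurable monotone
functionals and all measurable increasing events). [cite: LastSzekliYogeshwaran2020, Lemma 3.6; Lindqvist1988, Thm. 3.1] -/
theorem IsPositivelyAssociated.of_continuous_real_pi (μ : Measure (ι → ℝ)) [IsProbabilityMeasure μ]
    (h : ∀ f g : (ι → ℝ) → ℝ, Continuous f → Continuous g → Monotone f → Monotone g →
      (∀ x, 0 ≤ f x) → (∀ x, f x ≤ 1) → (∀ x, 0 ≤ g x) → (∀ x, g x ≤ 1) →
        (∫ x, f x ∂μ) * (∫ x, g x ∂μ) ≤ ∫ x, f x * g x ∂μ) :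
    IsPositivelyAssociated μ :=
  IsPositivelyAssociated.of_continuous_pi_of_dist (E := fun _ : ι => ℝ)
    (fun _ a b c hca => real_dist_sup_le a b c hca) μ h

/-- **Weak limits of positively associated laws on `ℝ^ι` are positively associated** (`ι` countable;
e.g. infinite-volume limits of finite-volume FKG lattice-field measures).
[cite: Lindqvist1988, Thm. 3.5; LastSzekliYogeshwaran2020, Thm. 3.7] -/
theorem isPositivelyAssociated_real_pi_of_tendsto {β : Type*} {l : Filter β} [l.NeBot]
    {μs : β → ProbabilityMeasure (ι → ℝ)} {μ : ProbabilityMeasure (ι → ℝ)}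
    (hlim : Tendsto μs l (𝓝 μ)) (hPA : ∀ k, IsPositivelyAssociated (μs k : Measure (ι → ℝ))) :
    IsPositivelyAssociated (μ : Measure (ι → ℝ)) :=
  isPositivelyAssociated_pi_of_tendsto_probabilityMeasure_of_dist (E := fun _ : ι => ℝ)
    (fun _ a b c hca => real_dist_sup_le a b c hca) hlim hPA

/-- **The Hilbert cube `ι → [0,1]`: continuous monotone test functions suffice.**
[cite: LastSzekliYogeshwaran2020, Lemma 3.6; Lindqvist1988, Thm. 3.1] -/
theorem IsPositivelyAssociated.of_continuous_hilbertCube (μ : Measure (ι → unitInterval))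
    [IsProbabilityMeasure μ]
    (h : ∀ f g : (ι → unitInterval) → ℝ, Continuous f → Continuous g → Monotone f → Monotone g →
      (∀ x, 0 ≤ f x) → (∀ x, f x ≤ 1) → (∀ x, 0 ≤ g x) → (∀ x, g x ≤ 1) →
        (∫ x, f x ∂μ) * (∫ x, g x ∂μ) ≤ ∫ x, f x * g x ∂μ) :
    IsPositivelyAssociated μ :=
  IsPositivelyAssociated.of_continuous_pi_of_dist (E := fun _ : ι => unitInterval)
    (fun _ a b c hca => subtype_dist_sup_le a b c hca) μ h

/-- **Weak limits of positively associated laws on the Hilbert cube `ι → [0,1]` are positively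
associated.** [cite: Lindqvist1988, Thm. 3.5; LastSzekliYogeshwaran2020, Thm. 3.7] -/
theorem isPositivelyAssociated_hilbertCube_of_tendsto {β : Type*} {l : Filter β} [l.NeBot]
    {μs : β → ProbabilityMeasure (ι → unitInterval)} {μ : ProbabilityMeasure (ι → unitInterval)}
    (hlim : Tendsto μs l (𝓝 μ))
    (hPA : ∀ k, IsPositivelyAssociated (μs k : Measure (ι → unitInterval))) :
    IsPositivelyAssociated (μ : Measure (ι → unitInterval)) :=
  isPositivelyAssociated_pi_of_tendsto_probabilityMeasure_of_dist (E := fun _ : ι => unitInterval)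
    (fun _ a b c hca => subtype_dist_sup_le a b c hca) hlim hPA

end RealFields

end Literature.Probability.Percolation
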